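import Summits.ResolutionOfSingularities.ResolutionOfSingularities.Theorems.PurelyInseparableDim4PhiLineUFreePart
import HarnessLib

/-!
# (K-Φ2) XVI: label propagation at a SUPERCRITICAL letter — (K-Φ2) X without the cleaning-exponent hypothesis `d ≤ e`
# (cell `res-dim4-pi`, slice C; input of the «heavy line» I-1-9 / I-1-10)

[OURS · counted 0 · cell `res-dim4-pi` · seat res-dim4-p-11 g5 (Φ-line lineage).]  Nothing here proves TAIL-D, K2(5)
(`RidgeBudget.NoAboveFloorTrap 5 5`) or resolution of singularities in dimension ≥ 4 / characteristic `p` — NOT proved.  AI kernel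
work, weaker than expert review.

(K-Φ2) X (`killVars_homogeneousComponent_linSubst_eq`, `uFree_nondegenerate`, `exists_label_readaptation_of_step`, p702381) computes the
`u`-free part of the child's initial form in frame coordinates, `(in_d σ_B G′)(Y, 0, 0) = ε(0)·Ψ(Y)`, from the residual decomposition
`G′ = ε·H₀ + R`, `R ∈ (x_h^e)`, under `d ≤ e` — used there only to get `ord₀ H₀ ≥ d`.  At a SUPERCRITICAL letter (`r_h + n = p`,
`n < d`) the correction lies in `(x_h^n)` only and the uncleaned weak transform `H₀` may have order `< d` («order-raising cleaning»,
bus 2026-08-29 07:18Z / res-dim4-crit-2 V-B-66: 2 of 167 in-class D∞ edges).  The identity nevertheless holds with `1 ≤ e` and NO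
order hypothesis: `σ_B G′ = σε·Ψ(Y) + X_u·(σε·σQ′) + σR`, the last two summands have no `u`-free monomial in any degree, and
`in_d(σε·Ψ(Y)) = ε(0)·Ψ(Y)` because `Ψ(Y)` is homogeneous of degree `d`.  This file proves that version and re-derives X's two
consumers from it:

* **`killVars_homogeneousComponent_linSubst_eq_pow`** (`1 ≤ e`, no `ord₀ G′`, no `d ≤ e`);
* **`uFree_nondegenerate_pow`**, **`exists_label_readaptation_of_step_pow`** — X's `uFree_nondegenerate` /
  `exists_label_readaptation_of_step` with `(hd1 : 1 ≤ d) (hde : d ≤ e)` replaced by `(he1 : 1 ≤ e)` (the latter keeps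
  `hdG : d ≤ ord₀ G′`, an input of (K-Φ2) IX).

[cite: CossartJannsenSaito2020, Lemma 12.2, Setup B (9.6)–(9.7), Def. 8.2 (3), Thm. 8.16] [cite: CossartPiltant2008, Prop. 4.2]
bears_on: LADDER-RESOLUTION:D157-DOOR2 (res-dim4-pi · slice C · Φ-line supercritical letter).  Supports
stmt-ResolutionOfSingularities-16155 (helper).
-/

set_option linter.dupNamespace false -- mandated namespace of this single-conjunct summit

noncomputable section

namespace Summit.ResolutionOfSingularities.ResolutionOfSingularities.Theorems.PIDim4

namespace PhiLine

open MvPolynomial Finset IsLocalRing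
open Literature.AlgebraicGeometry.Resolution
open Literature.AlgebraicGeometry.Resolution.Hauser2010
open Literature.AlgebraicGeometry.Resolution.WeightedOrder
open Literature.AlgebraicGeometry.Resolution.PointBlowup (additiveSubspace killVars)

variable {K : Type} [Field K]

/-- **`(in_d (σ_B G′))(Y, 0, 0) = ε(0)·Ψ(Y)`, order-free form.**  With `G′ = ε·H₀ + R` (`R ∈ (x_h^e)`, `1 ≤ e`),
`H₀ = Ψ(ℓ′) + x_j Q′` (`Ψ` a binary form of degree `d` in the `y′`-rows of the frame `A`), row `u` of `A` equal to `e_j`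
(`u ∈ {u₁, u₂}`) and row `u₁` equal to `e_h`: the `u`-free part of the degree-`d` component of `σ_B G′` is `ε(0)·Ψ(Y)` — whatever the
orders of `H₀`, `Q′`, `R`. [cite: CossartJannsenSaito2020, Lemma 12.2] [cite: CossartJannsenSaito2020, Setup B (9.7)] -/
theorem killVars_homogeneousComponent_linSubst_eq_pow {A B : Matrix (Fin 4) (Fin 4) K} (hAB : A * B = 1) {u : Fin (2 + 2)}
    (hu : u ∈ ({u1 2, u2 2} : Finset (Fin (2 + 2)))) {j h : Fin 4} (hAu : A u = Pi.single j 1) (hAu1 : A (u1 2) = Pi.single h 1)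
    {G' ε H₀ R Q' : MvPolynomial (Fin 4) K} {Ψ : MvPolynomial (Fin 2) K} {d e : ℕ} (he1 : 1 ≤ e)
    (hG' : G' = ε * H₀ + R) (hR : R ∈ Ideal.span {(X h : MvPolynomial (Fin 4) K) ^ e})
    (hH₀ : H₀ = aeval (fun k : Fin 2 => ∑ t, C (A (Fin.castAdd 2 k) t) * X t) Ψ + X j * Q') (hΨ : Ψ.IsHomogeneous d) :
    killVars ({u1 2, u2 2} : Finset (Fin (2 + 2))) (homogeneousComponent d (linSubst K B G')) =
      C (constantCoeff ε) * rename (Fin.castAdd 2) Ψ := by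
  classical
  set U : Finset (Fin (2 + 2)) := {u1 2, u2 2} with hU
  have hu1U : u1 2 ∈ U := by rw [hU]; exact Finset.mem_insert_self _ _
  -- frame coordinates
  have hcompA : (linSubst K B).comp (aeval fun k : Fin 2 => (∑ t, C (A (Fin.castAdd 2 k) t) * X t : MvPolynomial (Fin 4) K)) =
      rename (Fin.castAdd 2) :=
    MvPolynomial.algHom_ext fun k => by rw [AlgHom.comp_apply, aeval_X, linSubst_frameForm_eq_X hAB, rename_X]
  have hσH₀ : linSubst K B H₀ = rename (Fin.castAdd 2) Ψ + X u * linSubst K B Q' := by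
    rw [hH₀, map_add, map_mul, linSubst_X_eq_X_of_row_eq_single hAB hAu, ← AlgHom.comp_apply, hcompA]
  have hσR : linSubst K B R ∈ Ideal.span {(X (u1 2) : MvPolynomial (Fin 4) K) ^ e} := by
    obtain ⟨S, rfl⟩ := Ideal.mem_span_singleton'.mp hR
    rw [map_mul, map_pow, linSubst_X_eq_X_of_row_eq_single hAB hAu1]
    exact Ideal.mem_span_singleton'.mpr ⟨linSubst K B S, rfl⟩
  have hΨ4 : (rename (Fin.castAdd 2) Ψ : MvPolynomial (Fin 4) K).IsHomogeneous d := hΨ.rename_isHomogeneous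
  -- split: `σ_B G′ = C ε₀ · Ψ₄ + (σ_B ε − C ε₀) · Ψ₄ + X_u · (σ_B ε · σ_B Q′) + σ_B R`
  have hsplit : linSubst K B G' = C (constantCoeff ε) * rename (Fin.castAdd 2) Ψ +
      ((linSubst K B ε - C (constantCoeff ε)) * rename (Fin.castAdd 2) Ψ + X u * (linSubst K B ε * linSubst K B Q') +
        linSubst K B R) := by
    rw [hG', map_add, map_mul, hσH₀]; ring
  have hmid : (linSubst K B ε - C (constantCoeff ε)) * rename (Fin.castAdd 2) Ψ ∈
      Literature.AlgebraicGeometry.Resolution.originIdeal K 4 ^ (d + 1) := by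
    rw [pow_succ']
    refine Ideal.mul_mem_mul ?_ ?_
    · rw [originIdeal_eq_idealOfVars, ← one_le_ordZero_iff_mem_idealOfVars, one_le_ordZero_iff, map_sub, constantCoeff_C,
        constantCoeff_linSubst, sub_self]
    · rw [originIdeal_eq_idealOfVars, ← natCast_le_ordZero_iff_mem_idealOfVars_pow]
      exact le_ordZero_of_isHomogeneous hΨ4
  -- degree-`d` components and `u`-free parts
  have hcomp : homogeneousComponent d (linSubst K B G') =
      C (constantCoeff ε) * rename (Fin.castAdd 2) Ψ +
        (homogeneousComponent d (X u * (linSubst K B ε * linSubst K B Q')) + homogeneousComponent d (linSubst K B R)) := by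
    rw [hsplit, map_add, map_add, map_add, homogeneousComponent_C_mul, homogeneousComponent_eq_zero_of_mem_originIdeal_pow hmid,
      zero_add, homogeneousComponent_eq_self hΨ4]
  have hC : killVars U (C (constantCoeff ε)) = C (constantCoeff ε) := by rw [killVars, aeval_C, algebraMap_eq]
  have hΨ4k : killVars U (rename (Fin.castAdd 2) Ψ) = rename (Fin.castAdd 2) Ψ := by
    rw [← AlgHom.comp_apply]
    refine AlgHom.congr_fun (MvPolynomial.algHom_ext fun k => ?_) Ψ
    have hk : Fin.castAdd 2 k ∉ U := by
      rw [hU, Finset.mem_insert, Finset.mem_singleton, not_or]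
      exact ⟨castAdd_ne_u1 k, castAdd_ne_u2 k⟩
    rw [AlgHom.comp_apply, rename_X, killVars, aeval_X, if_neg hk]
  rw [hcomp, map_add, map_add, map_mul, killVars_homogeneousComponent_X_mul U hu, zero_add,
    killVars_homogeneousComponent_of_mem_span_X_pow U hu1U he1 hσR, add_zero, hC, hΨ4k]

/-- **`A(Ψ) = 0` ⇒ IX's `hF′` at the child**, order-free form of X's `uFree_nondegenerate` (`1 ≤ e` instead of `1 ≤ d ≤ e`).
[cite: CossartJannsenSaito2020, Lemma 12.2] -/
theorem uFree_nondegenerate_pow {A B : Matrix (Fin 4) (Fin 4) K} (hAB : A * B = 1) {u : Fin (2 + 2)}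
    (hu : u ∈ ({u1 2, u2 2} : Finset (Fin (2 + 2)))) {j h : Fin 4} (hAu : A u = Pi.single j 1) (hAu1 : A (u1 2) = Pi.single h 1)
    {G' ε H₀ R Q' : MvPolynomial (Fin 4) K} {Ψ : MvPolynomial (Fin 2) K} {d e : ℕ} (he1 : 1 ≤ e)
    (hG' : G' = ε * H₀ + R) (hε : constantCoeff ε ≠ 0) (hR : R ∈ Ideal.span {(X h : MvPolynomial (Fin 4) K) ^ e})
    (hH₀ : H₀ = aeval (fun k : Fin 2 => ∑ t, C (A (Fin.castAdd 2 k) t) * X t) Ψ + X j * Q') (hΨ : Ψ.IsHomogeneous d)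
    (hΨA : ∀ w ∈ additiveSubspace Ψ, w = 0) :
    ∀ v ∈ additiveSubspace (killVars ({u1 2, u2 2} : Finset (Fin (2 + 2))) (homogeneousComponent d (linSubst K B G'))),
      (∀ i ∈ ({u1 2, u2 2} : Finset (Fin (2 + 2))), v i = 0) → v = 0 := by
  classical
  intro v hv hvU
  have hv1 : v (u1 2) = 0 := hvU _ (Finset.mem_insert_self _ _)
  have hv2 : v (u2 2) = 0 := hvU _ (Finset.mem_insert_of_mem (Finset.mem_singleton_self _))
  rw [killVars_homogeneousComponent_linSubst_eq_pow hAB hu hAu hAu1 he1 hG' hR hH₀ hΨ, mem_additiveSubspace_iff_sum_smul_pderiv] at hv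
  simp_rw [pderiv_C_mul, ← mul_smul_comm, ← Finset.mul_sum] at hv
  rw [mul_eq_zero, C_eq_zero, or_iff_right hε, Fin.sum_univ_add] at hv
  simp only [Fin.sum_univ_two] at hv
  change v (Fin.castAdd 2 0) • pderiv (Fin.castAdd 2 0) (rename (Fin.castAdd 2) Ψ) +
      v (Fin.castAdd 2 1) • pderiv (Fin.castAdd 2 1) (rename (Fin.castAdd 2) Ψ) +
    (v (u1 2) • pderiv (u1 2) (rename (Fin.castAdd 2) Ψ) + v (u2 2) • pderiv (u2 2) (rename (Fin.castAdd 2) Ψ)) = 0 at hv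
  rw [hv1, hv2, zero_smul, zero_smul, add_zero, add_zero] at hv
  have hw : (fun k : Fin 2 => v (Fin.castAdd 2 k)) ∈ additiveSubspace Ψ := by
    rw [mem_additiveSubspace_iff_sum_smul_pderiv, Fin.sum_univ_two, smul_eq_C_mul, smul_eq_C_mul]
    apply rename_injective _ (Fin.castAdd_injective 2 2)
    rw [map_zero, map_add, map_mul, map_mul, rename_C, rename_C, ← pderiv_rename (Fin.castAdd_injective 2 2),
      ← pderiv_rename (Fin.castAdd_injective 2 2), ← smul_eq_C_mul, ← smul_eq_C_mul]
    exact hv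
  have hw0 := hΨA _ hw
  funext i
  induction i using Fin.addCases with
  | left k => exact congrFun hw0 k
  | right k =>
    fin_cases k
    · exact hv1
    · exact hv2

/-- **LABEL PROPAGATION at a supercritical letter**: (K-Φ2) X `exists_label_readaptation_of_step` with the cleaning exponent hypothesis
`d ≤ e` replaced by `1 ≤ e` (the order of the uncleaned weak transform `H₀` is irrelevant; `ord₀ G′ ≥ d` is kept as IX's input).
[cite: CossartJannsenSaito2020, Lemma 12.2, Def. 8.2 (3), Def. 8.4, Thm. 8.16] [cite: CossartPiltant2008, Prop. 4.2] -/
theorem exists_label_readaptation_of_step_pow (p : ℕ) [CharP K p] {d : ℕ} (hdp : d < p) {A B : Matrix (Fin 4) (Fin 4) K}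
    (hAB : A * B = 1) (hBA : B * A = 1) {u : Fin (2 + 2)} (hu : u ∈ ({u1 2, u2 2} : Finset (Fin (2 + 2)))) {j h : Fin 4}
    (hAu : A u = Pi.single j 1) (hAu1 : A (u1 2) = Pi.single h 1) {G' ε H₀ R Q' : MvPolynomial (Fin 4) K}
    {Ψ : MvPolynomial (Fin 2) K} {e : ℕ} (he1 : 1 ≤ e) (hG' : G' = ε * H₀ + R) (hdG : (d : ℕ∞) ≤ ordZero G')
    (hε : constantCoeff ε ≠ 0) (hR : R ∈ Ideal.span {(X h : MvPolynomial (Fin 4) K) ^ e})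
    (hH₀ : H₀ = aeval (fun k : Fin 2 => ∑ t, C (A (Fin.castAdd 2 k) t) * X t) Ψ + X j * Q') (hΨ : Ψ.IsHomogeneous d)
    (hΨA : ∀ w ∈ additiveSubspace Ψ, w = 0)
    (hT : 2 ≤ Module.finrank K (additiveSubspace (homogeneousComponent d G')))
    (hne : (pts (fun i : Fin (2 + 2) => algebraMap (MvPolynomial (Fin 4) K) (OriginLocalization K 4) (∑ t, C (A i t) * X t))
      (Ideal.span {algebraMap (MvPolynomial (Fin 4) K) (OriginLocalization K 4) G'}) d).Nonempty)
    (hα0 : 0 < alphaS (fun i : Fin (2 + 2) => algebraMap (MvPolynomial (Fin 4) K) (OriginLocalization K 4) (∑ t, C (A i t) * X t))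
      (Ideal.span {algebraMap (MvPolynomial (Fin 4) K) (OriginLocalization K 4) G'}) d)
    (hα1 : alphaS (fun i : Fin (2 + 2) => algebraMap (MvPolynomial (Fin 4) K) (OriginLocalization K 4) (∑ t, C (A i t) * X t))
      (Ideal.span {algebraMap (MvPolynomial (Fin 4) K) (OriginLocalization K 4) G'}) d < d.factorial) :
    ∃ lam : Fin 2 → K, ∃ A' B' : Matrix (Fin 4) (Fin 4) K, A' * B' = 1 ∧ B' * A' = 1 ∧
      (∀ k : Fin 2, A' (Fin.castAdd 2 k) = A (Fin.castAdd 2 k) + lam k • A (u1 2)) ∧ A' (u1 2) = A (u1 2) ∧ A' (u2 2) = A (u2 2) ∧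
      (pts (fun i : Fin (2 + 2) => algebraMap (MvPolynomial (Fin 4) K) (OriginLocalization K 4) (∑ t, C (A' i t) * X t))
        (Ideal.span {algebraMap (MvPolynomial (Fin 4) K) (OriginLocalization K 4) G'}) d).Nonempty ∧
      d.factorial < deltaS (fun i : Fin (2 + 2) => algebraMap (MvPolynomial (Fin 4) K) (OriginLocalization K 4) (∑ t, C (A' i t) * X t))
        (Ideal.span {algebraMap (MvPolynomial (Fin 4) K) (OriginLocalization K 4) G'}) d ∧
      alphaS (fun i : Fin (2 + 2) => algebraMap (MvPolynomial (Fin 4) K) (OriginLocalization K 4) (∑ t, C (A' i t) * X t))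
          (Ideal.span {algebraMap (MvPolynomial (Fin 4) K) (OriginLocalization K 4) G'}) d =
        alphaS (fun i : Fin (2 + 2) => algebraMap (MvPolynomial (Fin 4) K) (OriginLocalization K 4) (∑ t, C (A i t) * X t))
          (Ideal.span {algebraMap (MvPolynomial (Fin 4) K) (OriginLocalization K 4) G'}) d ∧
      betaS (fun i : Fin (2 + 2) => algebraMap (MvPolynomial (Fin 4) K) (OriginLocalization K 4) (∑ t, C (A' i t) * X t))
          (Ideal.span {algebraMap (MvPolynomial (Fin 4) K) (OriginLocalization K 4) G'}) d =
        betaS (fun i : Fin (2 + 2) => algebraMap (MvPolynomial (Fin 4) K) (OriginLocalization K 4) (∑ t, C (A i t) * X t))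
          (Ideal.span {algebraMap (MvPolynomial (Fin 4) K) (OriginLocalization K 4) G'}) d :=
  exists_label_readaptation p hdp hAB hBA hdG hT (uFree_nondegenerate_pow hAB hu hAu hAu1 he1 hG' hε hR hH₀ hΨ hΨA) hne hα0 hα1

end PhiLine

end Summit.ResolutionOfSingularities.ResolutionOfSingularities.Theorems.PIDim4

end
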